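import Summits.BirchSwinnertonDyer.BirchSwinnertonDyer.Theorems.SmallImageMuTransferMuTransferX9SelmerDualLocalFine
import Summits.BirchSwinnertonDyer.BirchSwinnertonDyer.Theorems.SmallImageMuTransferMuTransferX9SelmerDualLocalFineKernel
import Summits.BirchSwinnertonDyer.BirchSwinnertonDyer.Theorems.SmallImageMuTransferMuTransferX9SelmerDualLayer
import Summits.BirchSwinnertonDyer.BirchSwinnertonDyer.Theorems.SmallImageMuTransferMuTransferX9LocalExponentBadPrimes
import Literature.NumberTheory.EllipticCurves.SelmerCorankProofs
import HarnessLib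

/-!
# K6 crux `MuTransferX9` (stmt-BirchSwinnertonDyer-19276), stub `stub_selmerDualOdd` (skeleton v6),
# local condition at `p`, part 3: `(conj_γ − 1)^ε` kills the restriction of a fine class to `D_v ∩ Gal(K̄/K_n)`,
# UNIFORMLY in `n`

Cell `bsd-smallim`, seat `bsd-smallim-k6-c2` (gen 3). HONEST FRAMING: theorems only; nothing asserted about any
curve, nothing booked. Architecture (Lp-4c–e) of the seat's NOTES toward hypothesis (L-p) of
`SelmerDual.stub_selmerDualOdd_of_local`.  Setting: elliptic curve `E = W` over a number field `K`, prime
`p ≠ 2`, `ℤ_p`-extension `κ` with topological generators `γ` (arbitrary) and `γ̃ ∈ D_v` (a place `v ∣ p`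
TOTALLY RAMIFIED in `K_∞/K`: `κ(D_v) = ℤ_p`), `M = E[p]`, `H_n = D_v ∩ Gal(K̄/K_n)`, `U = D_v ∩ Gal(K̄/K_∞)`.

* `resH1Hom_decompInToH_conjH1` — restriction `H¹(Gal(K̄/K_n), M) → H¹(H_n, M)` intertwines `conj_d`
  (`d ∈ D_v`) computed in `Γ_K` and in `D_v`; `conjH1_iterate_eq_of_pow_mem` — `conj_d^{[k]} = id` on
  `H¹(H_n, M)` once `d^k ∈ H_n`.
* `iterate_conj_sub_id_eq_zero_of_pow` — **unipotent ⟹ nilpotent in characteristic `p`**: on a `p`-torsion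
  group, an additive `g` with `g^{[p^n]} = id` has `(g − id)^{[p^n]} = 0` (`p` odd; binomial theorem
  `Commute.exists_add_pow_prime_pow_eq` in `AddMonoid.End`).
* `exists_uniform_local_exponent` — **the uniform local exponent at `p`**: there is `ε` (depending on
  `E, p, κ, v` only: `ε = #E[p] + #B₁`, `B₁` the finite local Kummer kernel of part 1) such that for every
  `n`, every `y_n ∈ H¹(K_n, E[p])` whose restriction `y` to `K_∞` is FINE satisfies
  `res_{H_n} ((conj_γ − 1)^{[ε]} y_n) = 0`.  Mechanism (MU-TRANSFER-PROOF §5 STEP 1 at the place `p`):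
  `z = res_{H_n} y_n` lies in `V = res_U⁻¹(B₁)`, finite of order `≤ #M · #B₁` (part 2's inflation bound
  and part 1's Kummer kernel), stable under `g = conj_γ̃`; `g^{[p^n]} = id` (inner), so `g − id` is nilpotent
  on the `𝔽_p`-space `V`, hence `(g − id)^{[ε]} V = 0` by Cayley–Hamilton (k6-g4's
  `iterate_eq_zero_of_nilpotent_of_natCard_le`); finally `conj_γ̃ = conj_γ` on `H¹(Gal(K̄/K_n), M)`.
* `exists_uniform_local_exponent_resLe` — the same in the currency of `ContinuousCorestriction`
  (`resLe ρ.toTopRep (D_v ⊓ Gal(K̄/K_n) ≤ Gal(K̄/K_n))`), the input of the one-double-coset Mackey formula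
  `resSubgroup_cores_eq_zero_of_resLe_eq_zero` (p457304) for the Shapiro class `Sh⁻¹ y_n`.

PARTITION (D-0054): X9 (A4) × p ∈ {5,7} (+ X10b∧¬Surj at 3) — helper toward `stub_selmerDualOdd`; closes none.

References: HOME/koly/MU-TRANSFER-PROOF.md §5 STEP 1; R. Greenberg, LNM 1716 (1999) §3 [GreenbergLNM1716];
J. Neukirch, A. Schmidt, K. Wingberg (2008) I §5 [NeukirchSchmidtWingberg2008].
-/

set_option linter.dupNamespace false
set_option autoImplicit false

noncomputable section

open scoped NumberField
open Field IsDedekindDomain Function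
open WeierstrassCurve (geomTorsion geomPrimaryTorsion geomTorsion_le_geomPrimaryTorsion)
open Literature.NumberTheory.GaloisRepresentations
open Literature.NumberTheory.EllipticCurves
open Literature.NumberTheory.EllipticCurves.GreenbergSelmer

universe u

namespace Summit.BirchSwinnertonDyer.BirchSwinnertonDyer.Rank1Residual.SelmerDual

/-! ## Unipotent ⟹ nilpotent on a `p`-torsion group (`p` odd) -/

section Unipotent

/-- On an additive group killed by the odd prime `p`, an additive endomorphism `g` with `g^{[p^n]} = id`
satisfies `(g − id)^{[p^n]} = 0`: in the ring `End(V)`, `(g − 1)^{p^n} = g^{p^n} − 1 + p·(…)`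
(`Commute.exists_add_pow_prime_pow_eq`). [folklore] -/
theorem iterate_conj_sub_id_eq_zero_of_pow {V : Type*} [AddCommGroup V] {p : ℕ} [hp : Fact p.Prime]
    (hp2 : p ≠ 2) (hV : ∀ v : V, p • v = 0) (g : V →+ V) {n : ℕ} (hg : ∀ v, g^[p ^ n] v = v) (v : V) :
    (⇑(g - AddMonoidHom.id V))^[p ^ n] v = 0 := by
  have hodd : Odd (p ^ n) := (hp.out.odd_of_ne_two hp2).pow
  -- in the ring `AddMonoid.End V`
  let G : AddMonoid.End V := g
  obtain ⟨r, hr⟩ :=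
    Commute.exists_add_pow_prime_pow_eq hp.out ((Commute.one_right G).neg_right) n
  have hfun : ⇑(g - AddMonoidHom.id V) = ⇑(G + -1) := by
    funext w
    change g w - w = g w + -w
    rw [sub_eq_add_neg]
  have hpow : ∀ (X : AddMonoid.End V) (k : ℕ) (w : V), (X ^ k) w = (⇑X)^[k] w := fun X k w => by
    rw [AddMonoid.End.coe_pow]
  rw [hfun, ← hpow, hr, hodd.neg_one_pow]
  change (G ^ p ^ n) v + -v + ((p : AddMonoid.End V) * (G * (-1) * r)) v = 0
  rw [hpow, show (⇑G)^[p ^ n] v = v from hg v, add_neg_cancel, zero_add, AddMonoid.End.coe_mul,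
    Function.comp_apply, AddMonoid.End.natCast_apply, hV]

end Unipotent

/-! ## Conjugation on `H¹(D_v ∩ H, M)` versus conjugation on `H¹(H, M)` -/

section Conj

variable {K : Type u} [Field K] [NumberField K] (v : HeightOneSpectrum (𝓞 K))
  {M N : Type u} [AddCommGroup M] [DistribMulAction (absoluteGaloisGroup K) M] [TopologicalSpace M]
  [DiscreteTopology M] [AddCommGroup N] [DistribMulAction (absoluteGaloisGroup K) N] [TopologicalSpace N]
  [DiscreteTopology N]

/-- Restriction `H¹(H, M) → H¹(D_v ∩ H, M)` intertwines `conj_d` for `d ∈ D_v` (computed in `Γ_K`, resp.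
in `D_v`): both composites are induced by `(x ↦ d⁻¹ x d, m ↦ d • m)`. [cite: NeukirchSchmidtWingberg2008, I.§5] -/
theorem resH1Hom_decompInToH_conjH1 (H : Subgroup (absoluteGaloisGroup K)) [H.Normal] [(decompIn H v).Normal]
    (d : decomp v) (a : subgroupH1 H M) :
    resH1Hom (decompInToH H v) (AddMonoidHom.id M) (fun _ _ => rfl) (conjH1 H M (d : absoluteGaloisGroup K) a) =
      conjH1 (decompIn H v) M d (resH1Hom (decompInToH H v) (AddMonoidHom.id M) (fun _ _ => rfl) a) := by
  rw [conjH1, conjH1, ← AddMonoidHom.comp_apply, resH1Hom_comp, ← AddMonoidHom.comp_apply, resH1Hom_comp]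
  refine DFunLike.congr_fun (resH1Hom_congr (ContinuousMonoidHom.ext fun x => Subtype.ext ?_)
    (AddMonoidHom.ext fun _ => rfl) _ _) a
  change (d : absoluteGaloisGroup K)⁻¹ * ((x : decomp v) : absoluteGaloisGroup K) * d =
    (((d⁻¹ * (x : decomp v) * d : decomp v)) : absoluteGaloisGroup K)
  push_cast
  rfl

/-- A change of coefficients `ψ` (equivariant) commutes with `conj_d` on `H¹(H', ·)` for any normal
subgroup `H'` of a topological group. [cite: NeukirchSchmidtWingberg2008, I.§5] -/
theorem resH1Hom_id_conjH1 {G : Type u} [Group G] [TopologicalSpace G] [IsTopologicalGroup G]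
    {A B : Type u} [AddCommGroup A] [DistribMulAction G A] [TopologicalSpace A] [DiscreteTopology A]
    [AddCommGroup B] [DistribMulAction G B] [TopologicalSpace B] [DiscreteTopology B]
    (H' : Subgroup G) [H'.Normal] (ψ : A →+ B) (hψ : ∀ (g : G) (a : A), ψ (g • a) = g • ψ a) (d : G)
    (a : subgroupH1 H' A) :
    resH1Hom (ContinuousMonoidHom.id H') ψ (fun x m => hψ x m) (conjH1 H' A d a) =
      conjH1 H' B d (resH1Hom (ContinuousMonoidHom.id H') ψ (fun x m => hψ x m) a) := by
  rw [conjH1, conjH1, ← AddMonoidHom.comp_apply, resH1Hom_comp, ← AddMonoidHom.comp_apply, resH1Hom_comp]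
  exact DFunLike.congr_fun (resH1Hom_congr rfl (AddMonoidHom.ext fun m => hψ d m) _ _) a

/-- Restriction in `D_v` (from `D_v ∩ H'` to `D_v ∩ H`) after restriction from `H'` is restriction from `H`
after restriction in `Γ_K` (from `H'` to `H`). [cite: NeukirchSchmidtWingberg2008, I.§5] -/
theorem resOfLe_decompIn_resH1Hom_decompInToH {H H' : Subgroup (absoluteGaloisGroup K)} (hHH' : H ≤ H')
    (a : subgroupH1 H' M) :
    resOfLe M (decompIn_mono v hHH') (resH1Hom (decompInToH H' v) (AddMonoidHom.id M) (fun _ _ => rfl) a) =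
      resH1Hom (decompInToH H v) (AddMonoidHom.id M) (fun _ _ => rfl) (resOfLe M hHH' a) := by
  rw [resOfLe, resOfLe, ← AddMonoidHom.comp_apply, resH1Hom_comp, ← AddMonoidHom.comp_apply,
    resH1Hom_comp]
  exact DFunLike.congr_fun (resH1Hom_congr (ContinuousMonoidHom.ext fun _ => rfl) rfl _ _) a

/-- `conj_σ^{[k]} = conj_{σ^k}` on `H¹(H', A)`. [cite: NeukirchSchmidtWingberg2008, I.§5] -/
theorem conjH1_iterate {G : Type u} [Group G] [TopologicalSpace G] [IsTopologicalGroup G]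
    {A : Type u} [AddCommGroup A] [DistribMulAction G A] [TopologicalSpace A] [DiscreteTopology A]
    (H' : Subgroup G) [H'.Normal] (σ : G) (k : ℕ) (a : subgroupH1 H' A) :
    (conjH1 H' A σ)^[k] a = conjH1 H' A (σ ^ k) a := by
  induction k with
  | zero => rw [iterate_zero, pow_zero, conjH1_one_holds]; rfl
  | succ k ih => rw [iterate_succ_apply', ih, pow_succ', conjH1_mul_holds]; rfl

omit [NumberField K] in
/-- Every `p^n`-th power lies in `Gal(K̄/K_n)`. [cite: Washington1997, §13.1] -/
theorem pow_prime_pow_mem_layerSubgroup {p : ℕ} [Fact p.Prime] (κ : ZpExtension K p) (g : absoluteGaloisGroup K)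
    (n : ℕ) : g ^ p ^ n ∈ κ.layerSubgroup n := by
  rw [ZpExtension.mem_layerSubgroup, map_pow, toAdd_pow, nsmul_eq_mul, Nat.cast_pow]
  exact Dvd.intro _ rfl

/-- Classes of `H¹(H', E[p])`-type groups are killed by `p` when the coefficients are.
[folklore] -/
theorem prime_smul_subgroupH1_eq_zero {G : Type u} [Group G] [TopologicalSpace G] [IsTopologicalGroup G]
    {A : Type u} [AddCommGroup A] [DistribMulAction G A] [TopologicalSpace A] [DiscreteTopology A]
    {p : ℕ} (hA : ∀ a : A, p • a = 0) (c : discreteH1 G A) : p • c = 0 := by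
  obtain ⟨φ, rfl⟩ := oneCocycleClass_surjective _ c
  exact nsmul_oneCocycleClass_eq_zero φ p fun g => hA _

end Conj

/-! ## The uniform local exponent at a totally ramified place above `p` -/

section Main

variable {K : Type u} [Field K] [NumberField K] (W : WeierstrassCurve K) [W.IsElliptic] {p : ℕ}
  [hp : Fact p.Prime] (κ : ZpExtension K p) (v : HeightOneSpectrum (𝓞 K))

/-- **Uniform local exponent at a totally ramified place.** Let `p ≠ 2`, `κ` a `ℤ_p`-extension of the number
field `K` with a topological generator `γ̃ ∈ D_v` and `κ(D_v) = ℤ_p`, `E = W` an elliptic curve, `γ ∈ Γ_K`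
arbitrary.  There is `ε` (namely `#E[p] + #B₁`, `B₁` the local Kummer kernel at `v`) such that for every layer
`n` and every `y_n ∈ H¹(Gal(K̄/K_n), E[p])` whose restriction to `D_v ∩ Gal(K̄/K_∞)` lies in `B₁` (e.g. the
restriction of `y_n` to `K_∞` is FINE, part 1), the restriction of `(conj_γ − 1)^{[ε]} y_n` to
`D_v ∩ Gal(K̄/K_n)` vanishes. [cite: GreenbergLNM1716, §3 Lemma 3.1] -/
theorem exists_uniform_local_exponent (hp2 : p ≠ 2) {γt : absoluteGaloisGroup K}
    (hγt : κ.IsTopGenerator γt) (hγtD : γt ∈ decomp v)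
    (hsurj : ∀ g : absoluteGaloisGroup K, ∃ d ∈ decomp v, d⁻¹ * g ∈ κ.kerSubgroup)
    (γ : absoluteGaloisGroup K) :
    ∃ ε : ℕ, ∀ (n : ℕ) (yn : subgroupH1 (κ.layerSubgroup n) (geomTorsion W (p : ℤ))),
      resH1Hom (decompInToH κ.kerSubgroup v) (AddMonoidHom.id (geomTorsion W (p : ℤ))) (fun _ _ => rfl)
          (resOfLe (geomTorsion W (p : ℤ)) (κ.kerSubgroup_le_layerSubgroup n) yn) ∈
        (resH1Hom (ContinuousMonoidHom.id (decompIn κ.kerSubgroup v))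
          (AddSubgroup.inclusion (geomTorsion_le_geomPrimaryTorsion W p)) (fun _ _ => rfl) :
            subgroupH1 (decompIn κ.kerSubgroup v) (geomTorsion W (p : ℤ)) →+
              subgroupH1 (decompIn κ.kerSubgroup v) (geomPrimaryTorsion W p)).ker →
      resH1Hom (decompInToH (κ.layerSubgroup n) v) (AddMonoidHom.id (geomTorsion W (p : ℤ))) (fun _ _ => rfl)
        ((⇑(conjH1 (κ.layerSubgroup n) (geomTorsion W (p : ℤ)) γ -
          AddMonoidHom.id (subgroupH1 (κ.layerSubgroup n) (geomTorsion W (p : ℤ)))))^[ε] yn) = 0 := by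
  classical
  have hcont : ∀ m : geomTorsion W (p : ℤ), Continuous fun g : absoluteGaloisGroup K => g • m := fun m =>
    continuous_smul_of_isOpen_stabilizer m (W.isOpen_stabilizer_geomTorsion (p : ℤ) m)
  have hMp : ∀ m : geomTorsion W (p : ℤ), p • m = 0 := fun m => AddSubgroup.torsionBy.nsmul m
  haveI : Finite (geomTorsion W (p : ℤ)) :=
    WeierstrassCurve.finite_torsionPoints_holds W (AlgebraicClosure K)
      (Int.natCast_ne_zero.mpr hp.out.ne_zero)
  -- the finite local Kummer kernel `B₁`
  set B₁ := (resH1Hom (ContinuousMonoidHom.id (decompIn κ.kerSubgroup v))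
      (AddSubgroup.inclusion (geomTorsion_le_geomPrimaryTorsion W p)) (fun _ _ => rfl) :
        subgroupH1 (decompIn κ.kerSubgroup v) (geomTorsion W (p : ℤ)) →+
          subgroupH1 (decompIn κ.kerSubgroup v) (geomPrimaryTorsion W p)).ker with hB₁
  haveI hB₁fin : Finite B₁ := (finite_ker_localTorsionToPrimary W p v κ.kerSubgroup).to_subtype
  refine ⟨Nat.card (geomTorsion W (p : ℤ)) + Nat.card B₁, fun n yn hfine => ?_⟩
  haveI : (decompIn κ.kerSubgroup v).Normal := decompIn_normal κ.kerSubgroup v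
  haveI : (decompIn (κ.layerSubgroup n) v).Normal := decompIn_normal (κ.layerSubgroup n) v
  have h := decompIn_mono v (κ.kerSubgroup_le_layerSubgroup n)
  -- the inflation kernel (part 2) and `V = res⁻¹(B₁)`
  obtain ⟨hK₂fin, hK₂le⟩ := finite_ker_resOfLe_decompIn_and_card_le κ v hcont hγt hγtD hsurj n
  haveI := hK₂fin
  obtain ⟨hVfin, hVle⟩ := natCard_comap_le_mul (resOfLe (geomTorsion W (p : ℤ)) h) B₁
  set V := B₁.comap (resOfLe (geomTorsion W (p : ℤ)) h) with hV
  haveI : Finite V := hVfin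
  -- `z = res y_n ∈ V`
  set z := resH1Hom (decompInToH (κ.layerSubgroup n) v) (AddMonoidHom.id (geomTorsion W (p : ℤ)))
    (fun _ _ => rfl) yn with hz
  have hzV : z ∈ V := by
    rw [hV, AddSubgroup.mem_comap, hz, resOfLe_decompIn_resH1Hom_decompInToH]
    exact hfine
  -- the conjugating element inside `D_v`
  obtain ⟨d, hdD, hdγ⟩ := hsurj γ
  let dD : decomp v := ⟨d, hdD⟩
  set g := conjH1 (decompIn (κ.layerSubgroup n) v) (geomTorsion W (p : ℤ)) dD with hg
  -- `V` is `g`-stable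
  have hB₁stab : ∀ b ∈ B₁, conjH1 (decompIn κ.kerSubgroup v) (geomTorsion W (p : ℤ)) dD b ∈ B₁ :=
    fun b hb => by
    rw [hB₁, AddMonoidHom.mem_ker] at hb ⊢
    rw [resH1Hom_id_conjH1 (decompIn κ.kerSubgroup v) _ (fun _ _ => rfl) dD b, hb, map_zero]
  have hVstab : ∀ w ∈ V, g w ∈ V := fun w hw => by
    rw [hV, AddSubgroup.mem_comap] at hw ⊢
    rw [hg, show resOfLe (geomTorsion W (p : ℤ)) h (conjH1 _ _ dD w) =
        conjH1 (decompIn κ.kerSubgroup v) _ dD (resOfLe _ h w) from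
      DFunLike.congr_fun (resOfLe_comp_conjH1_holds (M := geomTorsion W (p : ℤ)) h dD) w]
    exact hB₁stab _ hw
  -- `g` restricted to `V`; unipotence `g^{[p^n]} = id` (inner action of `d^{p^n} ∈ D_v ∩ Gal(K̄/K_n)`)
  let gV : V →+ V := (g.comp V.subtype).codRestrict V (fun w => hVstab w w.2)
  have hgV : ∀ (k : ℕ) (w : V), ((gV^[k] w : V) : subgroupH1 (decompIn (κ.layerSubgroup n) v)
      (geomTorsion W (p : ℤ))) = g^[k] (w : subgroupH1 (decompIn (κ.layerSubgroup n) v) (geomTorsion W (p : ℤ))) := by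
    intro k
    induction k with
    | zero => intro w; rfl
    | succ k ih => intro w; rw [iterate_succ_apply', iterate_succ_apply', ← ih]; rfl
  have hTV : ∀ (k : ℕ) (w : V), (((⇑(gV - AddMonoidHom.id V))^[k] w : V) :
      subgroupH1 (decompIn (κ.layerSubgroup n) v) (geomTorsion W (p : ℤ))) =
      (⇑(g - AddMonoidHom.id (subgroupH1 (decompIn (κ.layerSubgroup n) v) (geomTorsion W (p : ℤ)))))^[k]
        (w : subgroupH1 (decompIn (κ.layerSubgroup n) v) (geomTorsion W (p : ℤ))) := by
    intro k
    induction k with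
    | zero => intro w; rfl
    | succ k ih => intro w; rw [iterate_succ_apply', iterate_succ_apply', ← ih]; rfl
  have hdn : (dD : decomp v) ^ p ^ n ∈ decompIn (κ.layerSubgroup n) v := by
    rw [mem_decompIn_iff]
    push_cast
    exact pow_prime_pow_mem_layerSubgroup κ d n
  have hunip : ∀ w : V, gV^[p ^ n] w = w := fun w => by
    apply Subtype.ext
    rw [hgV, hg, conjH1_iterate, conjH1_of_mem_holds _ _ hdn]
    rfl
  have hVp : ∀ w : V, p • w = 0 := fun w =>
    Subtype.ext (by
      rw [AddSubgroupClass.coe_nsmul, ZeroMemClass.coe_zero]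
      exact prime_smul_subgroupH1_eq_zero hMp
        (w : subgroupH1 (decompIn (κ.layerSubgroup n) v) (geomTorsion W (p : ℤ))))
  have hnil : ∀ w : V, (⇑(gV - AddMonoidHom.id V))^[p ^ n] w = 0 :=
    iterate_conj_sub_id_eq_zero_of_pow hp2 hVp gV hunip
  -- Cayley–Hamilton on the finite `𝔽_p`-space `V`
  have hp1 : 1 < p := hp.out.one_lt
  have hε : Nat.card V ≤ p ^ (Nat.card (geomTorsion W (p : ℤ)) + Nat.card B₁) :=
    calc Nat.card V ≤ Nat.card (resOfLe (geomTorsion W (p : ℤ)) h).ker * Nat.card B₁ := hVle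
      _ ≤ Nat.card (geomTorsion W (p : ℤ)) * Nat.card B₁ := Nat.mul_le_mul_right _ hK₂le
      _ ≤ p ^ Nat.card (geomTorsion W (p : ℤ)) * p ^ Nat.card B₁ :=
        Nat.mul_le_mul (Nat.lt_pow_self hp1).le (Nat.lt_pow_self hp1).le
      _ = p ^ (Nat.card (geomTorsion W (p : ℤ)) + Nat.card B₁) := (pow_add _ _ _).symm
  have hkill := LocalSplitPrime.iterate_eq_zero_of_nilpotent_of_natCard_le hVp (gV - AddMonoidHom.id V)
    hnil hε ⟨z, hzV⟩
  have hz0 : (⇑(g - AddMonoidHom.id (subgroupH1 (decompIn (κ.layerSubgroup n) v)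
      (geomTorsion W (p : ℤ)))))^[Nat.card (geomTorsion W (p : ℤ)) + Nat.card B₁] z = 0 := by
    have := congrArg Subtype.val hkill
    rwa [hTV] at this
  -- back to `conj_γ` on `H¹(Gal(K̄/K_n), M)`: `conj_γ = conj_d` there (`d⁻¹ γ ∈ Gal(K̄/K_∞)`)
  have hγd : conjH1 (κ.layerSubgroup n) (geomTorsion W (p : ℤ)) γ =
      conjH1 (κ.layerSubgroup n) (geomTorsion W (p : ℤ)) d := by
    have : γ = d * (d⁻¹ * γ) := by group
    rw [this, conjH1_mul_holds, conjH1_of_mem_holds _ _ (κ.kerSubgroup_le_layerSubgroup n hdγ)]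
    rfl
  rw [hγd, map_iterate_sub_id (resH1Hom (decompInToH (κ.layerSubgroup n) v)
    (AddMonoidHom.id (geomTorsion W (p : ℤ))) (fun _ _ => rfl)) (conjH1 (κ.layerSubgroup n) _ d) g
    (fun a => by rw [hg]; exact resH1Hom_decompInToH_conjH1 v (κ.layerSubgroup n) dD a)]
  exact hz0

omit [W.IsElliptic] hp in
/-- Restriction from `Gal(K̄/K_n)` to `D_v ∩ Gal(K̄/K_n)` (`decompInToH`) is injective after the restriction
of `ContinuousCorestriction` to the subgroup `D_v ⊓ Gal(K̄/K_n) ≤ Gal(K̄/K_n)`: the two differ by the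
tautological isomorphism `decompIn _ v ≅ D_v ⊓ _`. [cite: NeukirchSchmidtWingberg2008, I.§5] -/
theorem resLe_eq_zero_of_resH1Hom_decompInToH_eq_zero (H : Subgroup (absoluteGaloisGroup K))
    {c : subgroupH1 H (geomTorsion W (p : ℤ))}
    (hc : resH1Hom (decompInToH H v) (AddMonoidHom.id (geomTorsion W (p : ℤ))) (fun _ _ => rfl) c = 0) :
    resLe (W.torsionGaloisModule (p : ℤ)).toTopRep (inf_le_right : decomp v ⊓ H ≤ H) 1 c = 0 := by
  let e : decompIn H v →ₜ* ↥(decomp v ⊓ H) :=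
    { toFun := fun x => ⟨((x : decomp v) : absoluteGaloisGroup K),
        Subgroup.mem_inf.mpr ⟨x.1.2, (mem_decompIn_iff H v x).1 x.2⟩⟩
      map_one' := rfl
      map_mul' := fun _ _ => rfl
      continuous_toFun := (continuous_subtype_val.comp continuous_subtype_val).subtype_mk _ }
  let e' : ↥(decomp v ⊓ H) →ₜ* decompIn H v :=
    { toFun := fun x => ⟨⟨(x : absoluteGaloisGroup K), (Subgroup.mem_inf.mp x.2).1⟩,
        (mem_decompIn_iff H v _).2 (Subgroup.mem_inf.mp x.2).2⟩
      map_one' := rfl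
      map_mul' := fun _ _ => rfl
      continuous_toFun := (continuous_subtype_val.subtype_mk _).subtype_mk _ }
  have hinj := resH1Hom_injective_of_leftInverse (M := geomTorsion W (p : ℤ)) e e'
    (fun _ _ => rfl) (fun _ _ => rfl) (fun x => Subtype.ext rfl)
  have hfac : resH1Hom (decompInToH H v) (AddMonoidHom.id (geomTorsion W (p : ℤ))) (fun _ _ => rfl) =
      (resH1Hom e (AddMonoidHom.id (geomTorsion W (p : ℤ))) (fun _ _ => rfl)).comp
        (resOfLe (geomTorsion W (p : ℤ)) (inf_le_right : decomp v ⊓ H ≤ H)) := by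
    rw [resOfLe, resH1Hom_comp]
    exact resH1Hom_congr (ContinuousMonoidHom.ext fun _ => rfl) rfl _ _
  rw [hfac, AddMonoidHom.comp_apply] at hc
  change resOfLe (geomTorsion W (p : ℤ)) (inf_le_right : decomp v ⊓ H ≤ H) c = 0
  exact hinj (hc.trans (map_zero _).symm)

/-- **The uniform local exponent, in the currency of `ContinuousCorestriction`** (`resLe` to
`D_v ⊓ Gal(K̄/K_n)`), ready for the one-double-coset Mackey formula
`resSubgroup_cores_eq_zero_of_resLe_eq_zero`. [cite: GreenbergLNM1716, §3 Lemma 3.1] -/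
theorem exists_uniform_local_exponent_resLe (hp2 : p ≠ 2) {γt : absoluteGaloisGroup K}
    (hγt : κ.IsTopGenerator γt) (hγtD : γt ∈ decomp v)
    (hsurj : ∀ g : absoluteGaloisGroup K, ∃ d ∈ decomp v, d⁻¹ * g ∈ κ.kerSubgroup)
    (γ : absoluteGaloisGroup K) :
    ∃ ε : ℕ, ∀ (n : ℕ) (yn : subgroupH1 (κ.layerSubgroup n) (geomTorsion W (p : ℤ))),
      resH1Hom (decompInToH κ.kerSubgroup v) (AddMonoidHom.id (geomTorsion W (p : ℤ))) (fun _ _ => rfl)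
          (resOfLe (geomTorsion W (p : ℤ)) (κ.kerSubgroup_le_layerSubgroup n) yn) ∈
        (resH1Hom (ContinuousMonoidHom.id (decompIn κ.kerSubgroup v))
          (AddSubgroup.inclusion (geomTorsion_le_geomPrimaryTorsion W p)) (fun _ _ => rfl) :
            subgroupH1 (decompIn κ.kerSubgroup v) (geomTorsion W (p : ℤ)) →+
              subgroupH1 (decompIn κ.kerSubgroup v) (geomPrimaryTorsion W p)).ker →
      resLe (W.torsionGaloisModule (p : ℤ)).toTopRep
          (inf_le_right : decomp v ⊓ κ.layerSubgroup n ≤ κ.layerSubgroup n) 1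
        ((⇑(conjH1 (κ.layerSubgroup n) (geomTorsion W (p : ℤ)) γ -
          AddMonoidHom.id (subgroupH1 (κ.layerSubgroup n) (geomTorsion W (p : ℤ)))))^[ε] yn) = 0 := by
  obtain ⟨ε, hε⟩ := exists_uniform_local_exponent W κ v hp2 hγt hγtD hsurj γ
  exact ⟨ε, fun n yn hfine =>
    resLe_eq_zero_of_resH1Hom_decompInToH_eq_zero W v (κ.layerSubgroup n) (hε n yn hfine)⟩

end Main

end Summit.BirchSwinnertonDyer.BirchSwinnertonDyer.Rank1Residual.SelmerDual

end
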